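import Literature.NumberTheory.EllipticCurves.Kramer1981.KernelReductionTwoDivisible
import Literature.NumberTheory.EllipticCurves.ReductionInertiaInvarianceProofs
import HarnessLib

/-!
# Bridges for Kramer–Tunnell §6 over a local field: the kernel of reduction in the two
presentations, and Hensel's lemma for the real valuation ring

Two pieces of glue between the tree's presentations used by the `KramerTunnell1982/*` proof
files (Compositio Math. 46 (1982), §6 p. 327, the reduction sequence
`0 → E₁(K) → E⁰(K) → Ẽ_ns(k) → 0` behind "`N : E⁰(K) → E⁰(F)` is surjective"):

* `mem_kernel_iff_reducesToZero_congrEquiv` — for a valued field `(L, w)`, an `𝒪_w`-equation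
  `W₀` and an equation `X` over a subfield with `X_L = (W₀)_L` (the *Transport* presentation of
  `ReductionInertiaInvarianceProofs`), the chart kernel `FormalGroupChart.kernel w X_L` (`|x(P)| > 1`,
  used by `KernelReductionNormProofs`) is the kernel of reduction `E₁` of `ReductionHomomorphism`
  (`WeierstrassCurve.ReducesToZero`, used by `NonsingularReductionNormProofs`) under the identity
  on coordinates `Affine.Point.congrEquiv`;
* `integer_eq_valuationInteger`, `reductionHom_surjective_realValuation` — for a non-archimedean
  local field `K` and its real valuation `w` (`(w a : ℝ) = ‖a‖`), `𝒪_w = 𝒪[K]` as subrings, so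
  `𝒪_w` is henselian and the reduction homomorphism `E⁰(K) → Ẽ_ns(k)` of an `𝒪_w`-equation is
  onto (`WeierstrassCurve.reductionHom_surjective`).

Theorems only; no definition, no named fact, no `sorry` (D-0026: net debt `0`).

## References

* [SilvermanAEC2009] J. H. Silverman, *The Arithmetic of Elliptic Curves*, VII.1 (equations
  over `R`), VII.2 (`E₁`, the kernel of reduction), VII.2.1.
* [NeukirchANT1999] J. Neukirch, *Algebraic Number Theory*, Ch. II (3.8) (the valuation ring).
* [SerreLocalFields1979] J.-P. Serre, *Local Fields*, Ch. II §4 Prop. 7 (complete ⇒ henselian).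
* [KramerTunnell1982] K. Kramer, J. Tunnell, Compositio Math. 46 (1982), §6 p. 327.
-/

noncomputable section

open scoped Classical NNReal
open ValuativeRel
open Literature.NumberTheory.GaloisRepresentations
open Literature.NumberTheory.GaloisRepresentations.IsNonarchimedeanLocalField
open Literature.NumberTheory.EllipticCurves.FormalGroupChart
open _root_.WeierstrassCurve

universe u

namespace Literature.NumberTheory.EllipticCurves.KramerTunnell1982

open Literature.NumberTheory.EllipticCurves

/-! ## §1 `E₁` in the two presentations -/

section Kernel

variable {L : Type u} [Field L] {w : Valuation L ℝ≥0} (W₀ : WeierstrassCurve w.integer)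
  {F₀ : Type*} [Field F₀] [Algebra F₀ L] {X : WeierstrassCurve F₀}
  (hX : X.baseChange L = W₀.baseChange L)

include hX in
/-- `X_L` is `𝒪_w`-integral (it is `(W₀)_L`): a Weierstrass equation with coefficients in the
valuation ring, Silverman *AEC* VII.§1. [cite: SilvermanAEC2009, VII.1 (Weierstrass equations with coefficients in R, PDF p. 165)] -/
theorem isIntegral_of_baseChange_eq : (X.baseChange L).IsIntegral w.integer := ⟨⟨W₀, hX⟩⟩

/-- **The chart kernel is the kernel of reduction**: for `P ∈ X(L)`,
`P ∈ FormalGroupChart.kernel w X_L` (`P = O` or `|x(P)| > 1`) iff `P`, moved to `W₀` by the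
identity on coordinates, reduces to `Õ` (`WeierstrassCurve.ReducesToZero`: `x(P) ∉ 𝒪_w`).
Silverman, *AEC*, VII.2 (`E₁(K)`). [cite: SilvermanAEC2009, VII.2 Prop. 2.1 (PDF p. 167), E₁(K)] -/
theorem mem_kernel_iff_reducesToZero_congrEquiv (P : (X.baseChange L).toAffine.Point) :
    (haveI := isIntegral_of_baseChange_eq W₀ hX
     P ∈ kernel w (X.baseChange L)) ↔ W₀.ReducesToZero (Affine.Point.congrEquiv hX P) := by
  haveI := isIntegral_of_baseChange_eq W₀ hX
  rcases P with _ | ⟨x, y, h⟩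
  · rw [← Affine.Point.zero_def, map_zero]
    exact ⟨fun _ => WeierstrassCurve.reducesToZero_zero, fun _ => (kernel w (X.baseChange L)).zero_mem⟩
  · rw [some_mem_kernel_iff, Affine.Point.congrEquiv_some, WeierstrassCurve.reducesToZero_some_iff,
      not_mem_range_iff (Valuation.integer.integers w)]

end Kernel

/-! ## §2 The real valuation ring of a local field is `𝒪[K]`, hence henselian -/

section LocalField

variable {K : Type u} [Field K] [ValuativeRel K] [TopologicalSpace K] [IsNonarchimedeanLocalField K]
  {w : Valuation K ℝ≥0}
  (hw : ∀ a : K, (w a : ℝ) = algNorm K (algebraMap K (AlgebraicClosure K) a))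

include hw in
/-- For the real valuation `w` of a local field (`(w a : ℝ) = ‖a‖`), `𝒪_w = 𝒪[K]` as subrings of
`K` (the valuation ring is `{x : |x| ≤ 1}`, Neukirch *ANT* II (3.8)). [cite: NeukirchANT1999, Ch. II (3.8)] -/
theorem integer_eq_valuationInteger : w.integer = 𝒪[K] := by
  ext a
  change w a ≤ 1 ↔ a ∈ 𝒪[K]
  rw [← NNReal.coe_le_coe, hw, NNReal.coe_one]
  exact algNorm_algebraMap_le_one_iff

include hw in
/-- **Reduction `E⁰(K) → Ẽ_ns(k)` is onto over a local field** in the `𝒪_w`-presentation (`w` the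
real valuation of `K`): `𝒪_w = 𝒪[K]` is henselian (`K` is complete; Serre, *Local Fields*, II §4
Prop. 7), so the tree's `WeierstrassCurve.reductionHom_surjective` (Silverman VII.2.1, exactness
on the right of `0 → E₁ → E₀ → Ẽ_ns → 0`) applies.
[cite: SilvermanAEC2009, VII.2 Prop. 2.1 (PDF p. 167)] -/
theorem reductionHom_surjective_realValuation (W₀ : WeierstrassCurve w.integer) :
    Function.Surjective (W₀.reductionHom (Valuation.integer.integers w)) := by
  have hO : HenselianLocalRing 𝒪[K] := by
    letI := IsTopologicalAddGroup.rightUniformSpace K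
    haveI := isUniformAddGroup_of_addCommGroup (G := K)
    exact
      { is_henselian := fun f hf a₀ h₁ h₂ =>
          HenselianRing.is_henselian (I := 𝓂[K]) f hf a₀ h₁ (h₂.map _) }
  haveI : HenselianLocalRing w.integer := by rw [integer_eq_valuationInteger hw]; exact hO
  exact W₀.reductionHom_surjective (Valuation.integer.integers w)

end LocalField

end Literature.NumberTheory.EllipticCurves.KramerTunnell1982

end
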